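import Literature.Analysis.FluidPDE.TaoCarlemanRegionVorticity
import Summits.NavierStokesRegularity.NavierStokesRegularity.Theorems.PeepholeVorticityDoorCoreDefs

/-!
# S29 FILE 2, plate 6 (T): Stub A `RegionCarlemanVorticityS29` holds

Door S29 «PeepholeVorticityDoor» (toward item `stmt-NavierStokesRegularity-0056`, `NoTypeII`), FILE 2
skeleton `PeepholeVorticityDoorCoreDefs.lean` (§2, Stub A): Tao 2021, Prop. 4.3 for the backward
translated vorticity `U(s, y) = ω(t̄ − s, x₀ + y)` of a classical solution on the region `[-1,0) × B₁`.
The content is the Literature theorem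
`Literature.Analysis.FluidPDE.IsClassicalNSSolutionOnRegion.second_carleman_vorticity_region_of_lt`
(`Literature/Analysis/FluidPDE/TaoCarlemanRegionVorticity.lean`), whose statement is `RegionCarlemanVorticityS29`
with the generic quantities `cLHS`, `cX`, `cY` unfolded; the proof below is that theorem BY NAME
(definitional unfolding only).

WHAT THIS IS NOT: a helper for a door on a HYPOTHETICAL Type-I blow-up scenario; `PeepholeToCore`,
the door and 0056 are untouched here, and nothing in this file proves NS regularity.
-/

set_option linter.dupNamespace false

namespace Summit.NavierStokesRegularity.NavierStokesRegularity.Theorems.PeepholeVorticityDoor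

/-- **Stub A (L) of S29 FILE 2 holds**: `RegionCarlemanVorticityS29` — Tao 2021 Prop. 4.3 (tree
`TaoCarleman.second_carleman_inequality`, absolute constant `Kt`) for `U s y = curl (u (t̄ − s)) (x₀ + y)`,
`(u, p)` classical on `[-1,0) × B₁`, Carleman cylinder inside `(-1,0) × B(0,½)`, (5.5) on
`[t̄ − T', t̄] × B̄(x₀, r)` — by name from the Literature region Carleman theorem. [folklore] -/
theorem regionCarlemanVorticityS29_holds : RegionCarlemanVorticityS29 :=
  Literature.Analysis.FluidPDE.IsClassicalNSSolutionOnRegion.second_carleman_vorticity_region_of_lt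

end Summit.NavierStokesRegularity.NavierStokesRegularity.Theorems.PeepholeVorticityDoor
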